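import Summits.ResolutionOfSingularities.ResolutionOfSingularities.Theorems.WildConesCampaignW46HypersurfacesCharTwoTangentCone

/-!
# [OURS · L1 W4.6, rung (ii) at p = 2, EVERY dimension n] THE EMBEDDING DIMENSION NEVER INCREASES under a
# point blow-up: `e(successor) ≤ e(c)` for every double point with a double successor (hypersurface
# double points `z² = a(u₁,…,uₙ)`, every field of characteristic 2); at `e = 2` the successor has
# `e ∈ {0, 2}`

HONEST FRAMING. Everything here is OURS: theorems about route WildCones' own TYPED point-blow-up
dynamics (`Theorems/WildConesClassicalRegimesDefs.lean`) and gen 3's invariant `milnorEmbDim = e`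
(p498937, the embedding dimension of the Milnor algebra = corank of the polar form of the cleaned
quadratic part). Nothing here is a statement of H. Hironaka's manuscript [Hironaka2017] and nothing of it
is used; no FACT-LIST premise. AI review is weaker than expert review. Cell res-hironaka
(LADDER-RESOLUTION rung L, D-0089), slot W4.6, seat res-L1-s46-pv-4 (gen 4); host route `WildCones`, crux
`ClassicalRegimes` (stmt-ResolutionOfSingularities-16884, proved); `--supports` that item as a helper.

WHAT IS HERE. Gen 3 proved `e(successor) = e(c)` INSIDE the regime `e ≤ 1` (`hypersurface_regime_step`).
Here, for every double state with a double successor and no other hypothesis: **`e(successor) ≤ e(c)`**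
(`hypersurface_milnorEmbDim_step_le`) — the hyperbolic pairs of the cleaned quadratic form survive the
blow-up (after the tree's descent `descent_step` along the pairs away from the chart index, the residual
has `e(c)` variables and the successor's residual lives in at most as many). With the parity
`e ≡ n (mod 2)` (gen 3): a double successor of an `e = 2` state has `e = 0` or `e = 2`
(`hypersurface_milnorEmbDim_step_of_eq_two`) — the two cases of `…TangentCone.lean` /
`…IsolTransfer.lean` (new hyperbolic pair at a simple tangent; none at a multiple tangent).

References: G.-M. Greuel, G. Pfister, The splitting lemma in any characteristic, J. Algebra 689 (2026)
= arXiv:2507.17078 [GreuelPfister2026] (through the tree's `descent_step`); H. Hironaka, ms. 2017-03-23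
[Hironaka2017] — ROLE only (Th. 16.6 p.84), under adjudication, never as fact.
-/

noncomputable section

-- single-problem summit: the doubled namespace component `ResolutionOfSingularities` is forced
set_option linter.dupNamespace false

open scoped BigOperators Classical

open MvPowerSeries IsLocalRing

open Literature.AlgebraicGeometry.Resolution

namespace Summit.ResolutionOfSingularities.ResolutionOfSingularities.Theorems

namespace CampaignW46.HypersurfacesCharTwo

open WildCones WildCones.MuDropCharTwoOrdP ThreefoldsCharTwo

variable {κ : Type} [Field κ]

/-- [OURS · L1 W4.6] **THE FORMAL MONOTONICITY OF THE EMBEDDING DIMENSION** (characteristic two, every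
`n`): for the blow-up relation `X_i² G = a∘Φ_{i,τ}` (`ord a ≥ 2`, `G` without linear terms),
`jetTwoColength G ≤ jetTwoColength a`. Strong induction on `n` along the tree's `descent_step`
(`exists_pair_ne`); at the leaf (no hyperbolic pair in `a`) `jetTwoColength a = n + 1` is the maximum.
[cite: GreuelPfister2026, Thm 3.5 and Cor 3.7] -/
theorem formal_jetTwoColength_strict_le [CharP κ 2] : ∀ (n : ℕ) (i : Fin n) (τ : Fin n → κ)
    (a G : MvPowerSeries (Fin n) κ), 2 ≤ a.order → (∀ s, coeff (Finsupp.single s 1) G = 0) →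
    X i ^ 2 * G = subst (fun s => if s = i then (X i : MvPowerSeries (Fin n) κ)
      else X i * (X s + C (τ s))) a → jetTwoColength G ≤ jetTwoColength a := by
  intro n
  induction n using Nat.strong_induction_on with
  | _ n ih =>
  intro i τ a G ha hG0 hG
  by_cases hpair : ∃ j l : Fin n, j ≠ l ∧ coeff (Finsupp.single j 1 + Finsupp.single l 1) a ≠ 0
  · obtain ⟨j, l, hjl, hj, hl, hq⟩ := exists_pair_ne i τ ha hG hG0 hpair
    obtain ⟨e, i', he, hi', -⟩ := exists_compl_embedding hjl (Ne.symm hj) (Ne.symm hl)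
    obtain ⟨a', G', ha', hG0', hG', ⟨εa⟩, ⟨εG⟩⟩ :=
      descent_step i τ ha hG0 hG hjl hj hl hq e he i' hi'
    have hlt : n - 2 < n := by
      have := Fin.pos i
      omega
    rw [jetTwoColength_eq_of_equiv εa, jetTwoColength_eq_of_equiv εG]
    exact ih (n - 2) hlt i' (fun t => τ (e t)) a' G' ha' hG0' hG'
  · push Not at hpair
    have ha' := (FormalCoordChange.two_le_order_iff a).mp ha
    rw [jetTwoColength_of_no_pair ha'.2 hpair, ← jetTwoColength_sub_C G (constantCoeff G)]
    exact (jetTwoColength_range (two_le_order_sub_C hG0)).2.1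

section States

variable {n : ℕ}

/-- [OURS · L1 W4.6 rung (ii) at `p = 2`, every dimension; NOT a statement of the manuscript] **THE
EMBEDDING DIMENSION NEVER INCREASES UNDER A POINT BLOW-UP** (hypersurface double points
`z² = a(u₁,…,uₙ)`, any field of characteristic `2`, any `n`, any chart, any translation): if a double
state `c` has a double successor `step i τ c`, then `e(step i τ c) ≤ e(c)` — the corank of the polar
form does not grow (the hyperbolic pairs survive; new ones may appear). No isolatedness is assumed.
[cite: GreuelPfister2026, Thm 3.5 and Cor 3.7] -/
theorem hypersurface_milnorEmbDim_step_le [CharP κ 2] (c : (Fin n → ℕ) → κ) (i : Fin n)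
    (τ : Fin n → κ) (hM : MultP 2 n κ c) (hM' : MultP 2 n κ (step 2 n κ i τ c)) :
    milnorEmbDim 2 n κ (step 2 n κ i τ c) ≤ milnorEmbDim 2 n κ c := by
  obtain ⟨G, ha, hG0, hG, -, hj'⟩ := dictCharTwo c i τ hM hM'
  have h := formal_jetTwoColength_strict_le n i τ (ser 2 n κ c) G ha hG0 hG
  unfold milnorEmbDim
  rw [jetTwoColength_ser_eq_of_jac_eq hj']
  omega

/-- [OURS · L1 W4.6 rung (ii) at `p = 2`, every dimension; NOT a statement of the manuscript] At
`e(c) = 2` a double successor has `e = 0` (a new hyperbolic pair: then it is isolated with `μ = 1`,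
gen 3's `milnorEmbDim_eq_zero_iff`) or `e = 2` (no new pair), by monotonicity and the parity
`e ≡ n (mod 2)`. [folklore] -/
theorem hypersurface_milnorEmbDim_step_of_eq_two [CharP κ 2] (c : (Fin n → ℕ) → κ) (i : Fin n)
    (τ : Fin n → κ) (hM : MultP 2 n κ c) (he : milnorEmbDim 2 n κ c = 2)
    (hM' : MultP 2 n κ (step 2 n κ i τ c)) :
    milnorEmbDim 2 n κ (step 2 n κ i τ c) = 0 ∨ milnorEmbDim 2 n κ (step 2 n κ i τ c) = 2 := by
  have hle := hypersurface_milnorEmbDim_step_le c i τ hM hM'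
  have hp := (milnorEmbDim_le_and_mod_two hM).2.1
  have hp' := (milnorEmbDim_le_and_mod_two hM').2.1
  omega

/-- [OURS · L1 W4.6 rung (ii) at `p = 2`, every dimension; NOT a statement of the manuscript] Along a
run of double points the embedding dimension is non-increasing: `e(c_m) ≤ e(c₀)` as long as
`c_0, …, c_m` are double points. [folklore] -/
theorem hypersurface_milnorEmbDim_run_le [CharP κ 2] (c₀ : (Fin n → ℕ) → κ) (i : ℕ → Fin n)
    (t : ℕ → Fin n → κ) {M : ℕ} (hrun : ∀ m ≤ M, MultP 2 n κ (run 2 n κ c₀ i t m)) :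
    ∀ m ≤ M, milnorEmbDim 2 n κ (run 2 n κ c₀ i t m) ≤ milnorEmbDim 2 n κ c₀ := by
  intro m
  induction m with
  | zero => intro _; exact le_rfl
  | succ m ih =>
    intro hm
    exact (hypersurface_milnorEmbDim_step_le (run 2 n κ c₀ i t m) (i m) (t m) (hrun m (by omega))
      (hrun (m + 1) hm)).trans (ih (by omega))

end States

end CampaignW46.HypersurfacesCharTwo

end Summit.ResolutionOfSingularities.ResolutionOfSingularities.Theorems

end
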